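import Summits.QuantumAdvantage.QuantumAdvantage.Theorems.CharDialMaskDialA
import Summits.QuantumAdvantage.QuantumAdvantage.Theorems.CharDialSegmentMovesD
import HarnessLib
import Summits.QuantumAdvantage.QuantumAdvantage.Theorems.CharDialMaskDialF

/-!
# CharDial / JLinPeel — the FLIP COUNT (route `CharDial`, item 32604 `WalkHardFJLinOdd`; lens-6 node g18 §10.2)

Generic, field-theory-free lemmas behind every ROBUST escape from the freeze-move dials (block ⊆ null ⊆ mask):

* `flip_base` — ★ the FLIP CRITERION from an ACCEPTED BASE POINT: if cut `g` of the presented strategy is, canonically, the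
  junta-free form-acceptance test `u ↦ [c = Σ_{u_i} a i]`, and `a` has at least `p − 1` non-zero coefficients outside a set `W`,
  then in ANY junta ⊕ one-form presentation `D` of the strategy, `W ∩ J_D(g) = ∅` and `Σ_{i∈W} D.a g i = 0` force the
  CANONICAL zero-sum `Σ_{i∈W} a i = 0` (a subset-sum base point `u₀ ⊆ Wᶜ` with `a·u₀ = c` exists by `subsetSum_surj`;
  `u₀` and `u₀ ∪ W` have equal junta bits and equal presented form value, hence equal outputs, hence `a·𝟙_W = 0`).
* `exists_block_free_all` — the COUNT: `M` pairwise disjoint blocks and `R` juntas of size `≤ L` with `R·L < M` leave a block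
  missing ALL `R` juntas (an injection into `Σ r, J r`).
* `flipCount` — ★ the two combined over the masked blocks `zblk ℓ S Z k` of part 31C: if the (inlined) mask-dial zero-sum
  hypothesis holds for a presentation `D` with juntas `≤ L`, and columns `r < R` are the canonical coefficient vectors of
  form-acceptance cuts `gr r`, each with `≥ p − 1` non-zero coefficients off every masked block, and `R·L < M`, then SOME masked
  block is zero-sum for ALL `R` canonical columns SIMULTANEOUSLY.  (For one column this is the engine of parts 31B/31H
  (`res2_not_null`); for `R → ∞` columns it is the engine of the planned class⁵ inhabitant «fieldY», node §10.)
-/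

set_option autoImplicit false

namespace Summit.QuantumAdvantage.AdviceFreeQNC0.JLinPeel.FlipCount

open Finset MaskDial BlockDial SegMove

section Flip
variable {p n : ℕ}

/-- the presented form at an indicator input. -/
theorem form_indicator (D : JLinData p n) (g : Fin (n + 1)) (W : Finset (Fin n)) :
    D.form g (fun i => decide (i ∈ W)) = ∑ i ∈ W, D.a g i := by
  unfold JLinData.form
  exact Summit.QuantumAdvantage.AdviceFreeQNC0.JLinPeel.MaskDial.ite_mem_sum (D.a g) W

/-- ★ **FLIP CRITERION from an accepted base point.**  Cut `g` is canonically the junta-free test `[c = a·u]`; `W` misses the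
presented junta of `g`, the presented form is zero-sum on `W`, and `a` has `≥ p − 1` non-zero coefficients outside `W`:
then `a` is zero-sum on `W`. -/
theorem flip_base [hp : Fact p.Prime] (D : JLinData p n) (g : Fin (n + 1)) (a : Fin n → ZMod p) (c : ZMod p)
    (hy : ∀ u, D.strat g u = decide (c = ∑ i, if u i then a i else 0))
    (W : Finset (Fin n)) (hWJ : ∀ i ∈ W, i ∉ D.J g)
    (hT : p ≤ ((univ \ W).filter fun i => a i ≠ 0).card + 1)
    (hsum : ∑ i ∈ W, D.a g i = 0) :
    ∑ i ∈ W, a i = 0 := by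
  classical
  set T : Finset (Fin n) := (univ \ W).filter fun i => a i ≠ 0 with hT'
  obtain ⟨S, hST, hS⟩ := subsetSum_surj a T (fun j hj => (mem_filter.1 hj).2) hT 0 c
  rw [zero_add] at hS
  have hSW : Disjoint S W := by
    rw [Finset.disjoint_left]
    intro i hi hiW
    have := (mem_sdiff.1 (mem_filter.1 (hST hi)).1).2
    exact this hiW
  set u0 : Fin n → Bool := fun i => decide (i ∈ S) with hu0
  set u1 : Fin n → Bool := fun i => decide (i ∈ S ∪ W) with hu1
  have hform0 : D.form g u0 = ∑ i ∈ S, D.a g i := by rw [hu0, form_indicator]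
  have hform1 : D.form g u1 = ∑ i ∈ S, D.a g i := by
    rw [hu1, form_indicator, Finset.sum_union hSW, hsum, add_zero]
  have hagree : ∀ i ∈ D.J g, u0 i = u1 i := by
    intro i hi
    have hiW : i ∉ W := fun hW => hWJ i hW hi
    simp [u0, u1, hiW]
  have hpres : D.strat g u0 = D.strat g u1 := by
    show D.h g u0 (D.form g u0) = D.h g u1 (D.form g u1)
    rw [hform0, hform1, D.hJ g u0 u1 hagree]
  rw [hy u0, hy u1, hu0, hu1, Summit.QuantumAdvantage.AdviceFreeQNC0.JLinPeel.MaskDial.ite_mem_sum, Summit.QuantumAdvantage.AdviceFreeQNC0.JLinPeel.MaskDial.ite_mem_sum, Finset.sum_union hSW, hS] at hpres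
  have h1 : decide (c = c + ∑ i ∈ W, a i) = true := by rw [← hpres]; exact decide_eq_true rfl
  have h2 := (decide_eq_true_eq.mp h1)
  -- `c = c + Σ_W a` ⇒ `Σ_W a = 0`
  have := congrArg (fun x => x - c) h2
  simpa using this.symm

end Flip

section Count
variable {n : ℕ}

/-- **THE COUNT**: among `M` pairwise disjoint blocks, if `R` juntas of size `≤ L` are given and `R·L < M`, some block misses
every junta. -/
theorem exists_block_free_all {M R L : ℕ} (B : Fin M → Finset (Fin n))
    (hdisj : ∀ k k' : Fin M, k ≠ k' → Disjoint (B k) (B k'))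
    (J : Fin R → Finset (Fin n)) (hJ : ∀ r, (J r).card ≤ L) (hM : R * L < M) :
    ∃ k : Fin M, ∀ r, ∀ i ∈ B k, i ∉ J r := by
  classical
  by_contra h
  push Not at h
  choose fr fi hfi hfJ using h
  -- `k ↦ ⟨fr k, fi k⟩` injects `Fin M` into `Σ r, J r`
  let f : Fin M → (Σ _ : Fin R, Fin n) := fun k => ⟨fr k, fi k⟩
  have hinj : Function.Injective f := by
    intro k k' hkk
    have h0 : fr k = fr k' ∧ fi k = fi k' := by simpa [f] using hkk
    have h1 : fi k = fi k' := h0.2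
    by_contra hne
    have hd := hdisj k k' hne
    exact Finset.disjoint_left.1 hd (hfi k) (h1 ▸ hfi k')
  have hsub : univ.image f ⊆ univ.sigma J := by
    intro x hx
    obtain ⟨k, -, rfl⟩ := mem_image.1 hx
    exact Finset.mem_sigma.2 ⟨mem_univ _, hfJ k⟩
  have h1 : (univ.image f).card = M := by rw [card_image_of_injective _ hinj, card_univ, Fintype.card_fin]
  have h2 : (univ.sigma J).card ≤ R * L := by
    rw [Finset.card_sigma]
    calc ∑ r, (J r).card ≤ ∑ _r : Fin R, L := Finset.sum_le_sum fun r _ => hJ r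
      _ = R * L := by simp
  have := card_le_card hsub
  omega

/-- masked blocks of separated spans are pairwise disjoint (pointwise form of part 31C's `zblk_disjoint`). -/
theorem zblk_disjoint_ne {M ℓ : ℕ} {S : Fin M → ℕ} {Z : Finset (Fin n)}
    (hS : (∀ k k' : Fin M, k < k' → S k + ℓ ≤ S k') ∧ (∀ k : Fin M, S k + ℓ ≤ n))
    (k k' : Fin M) (hne : k ≠ k') : Disjoint (zblk (n := n) ℓ S Z k) (zblk ℓ S Z k') := by
  rw [Finset.disjoint_left]
  intro i hi hi'
  rw [mem_zblk] at hi hi'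
  rcases lt_or_gt_of_ne hne with hlt | hlt
  · have := hS.1 k k' hlt; omega
  · have := hS.1 k' k hlt; omega

end Count

section FlipCount
variable {p n : ℕ}

/-- ★ **THE FLIP COUNT.**  Let `D` (juntas `≤ L`) satisfy the inlined mask-dial zero-sum hypothesis on the masked blocks of a
separated span system with `M` spans; let `R` columns `col r` be the canonical coefficient vectors of form-acceptance cuts
`gr r` (`D.strat (gr r) u = [c r = col r · u]`), each with `≥ p − 1` non-zero coefficients off every masked block; if
`R·L < M` then some masked block is zero-sum for ALL `R` canonical columns at once. -/
theorem flipCount [hp : Fact p.Prime] (D : JLinData p n) {L : ℕ} (hJ : ∀ g, (D.J g).card ≤ L)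
    {R : ℕ} (col : Fin R → Fin n → ZMod p) (c : Fin R → ZMod p) (gr : Fin R → Fin (n + 1))
    (hy : ∀ r u, D.strat (gr r) u = decide (c r = ∑ i, if u i then col r i else 0))
    {ℓ M : ℕ} {S : Fin M → ℕ} {Z : Finset (Fin n)}
    (hS : (∀ k k' : Fin M, k < k' → S k + ℓ ≤ S k') ∧ (∀ k : Fin M, S k + ℓ ≤ n))
    (hT : ∀ r (k : Fin M), p ≤ ((univ \ zblk ℓ S Z k).filter fun i => col r i ≠ 0).card + 1)
    (hmask : ∀ g (k : Fin M), ∑ i ∈ zblk ℓ S Z k, D.a g i = 0)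
    (hRL : R * L < M) :
    ∃ k : Fin M, ∀ r, ∑ i ∈ zblk ℓ S Z k, col r i = 0 := by
  obtain ⟨k, hk⟩ := exists_block_free_all (fun k => zblk ℓ S Z k) (fun k k' hne => zblk_disjoint_ne hS k k' hne)
    (fun r => D.J (gr r)) (fun r => hJ (gr r)) hRL
  exact ⟨k, fun r => flip_base D (gr r) (col r) (c r) (hy r) _ (hk r) (hT r k) (hmask (gr r) k)⟩

/-- the same count with `t` extra free blocks: `R·L + t ≤ M` leaves `t` masked blocks, pairwise distinct, each zero-sum for all
`R` columns (stated for `t = 2`, the form used by node §10: two universally zero-sum clustered sets). -/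
theorem flipCount_two [hp : Fact p.Prime] (D : JLinData p n) {L : ℕ} (hJ : ∀ g, (D.J g).card ≤ L)
    {R : ℕ} (col : Fin R → Fin n → ZMod p) (c : Fin R → ZMod p) (gr : Fin R → Fin (n + 1))
    (hy : ∀ r u, D.strat (gr r) u = decide (c r = ∑ i, if u i then col r i else 0))
    {ℓ M : ℕ} {S : Fin M → ℕ} {Z : Finset (Fin n)}
    (hS : (∀ k k' : Fin M, k < k' → S k + ℓ ≤ S k') ∧ (∀ k : Fin M, S k + ℓ ≤ n))
    (hT : ∀ r (k : Fin M), p ≤ ((univ \ zblk ℓ S Z k).filter fun i => col r i ≠ 0).card + 1)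
    (hmask : ∀ g (k : Fin M), ∑ i ∈ zblk ℓ S Z k, D.a g i = 0)
    (hRL : R * L + 2 ≤ M) :
    ∃ k k' : Fin M, k ≠ k' ∧ (∀ r, ∑ i ∈ zblk ℓ S Z k, col r i = 0) ∧ (∀ r, ∑ i ∈ zblk ℓ S Z k', col r i = 0) := by
  classical
  obtain ⟨k, hk⟩ := flipCount D hJ col c gr hy hS hT hmask (by omega)
  -- rerun the count on the `M − 1` blocks other than `k`
  have hM1 : R * L < M - 1 := by omega
  have hMpos : 0 < M := by omega
  let e : Fin (M - 1) → Fin M := fun j => if j.val < k.val then ⟨j.val, by omega⟩ else ⟨j.val + 1, by omega⟩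
  have he_ne : ∀ j, e j ≠ k := by
    intro j h
    have := congrArg Fin.val h
    simp only [e] at this
    split_ifs at this with hj <;> simp at this <;> omega
  have he_inj : Function.Injective e := by
    intro j j' h
    have := congrArg Fin.val h
    simp only [e] at this
    ext
    split_ifs at this with h1 h2 h2 <;> simp at this <;> omega
  obtain ⟨j, hj⟩ := exists_block_free_all (fun j => zblk ℓ S Z (e j))
    (fun j j' hne => zblk_disjoint_ne hS (e j) (e j') (fun h => hne (he_inj h)))
    (fun r => D.J (gr r)) (fun r => hJ (gr r)) hM1
  refine ⟨k, e j, (he_ne j).symm, hk, fun r => ?_⟩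
  exact flip_base D (gr r) (col r) (c r) (hy r) _ (hj r) (hT r (e j)) (hmask (gr r) (e j))

end FlipCount

end Summit.QuantumAdvantage.AdviceFreeQNC0.JLinPeel.FlipCount
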